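import Summits.Ventures.HSemireg.WedgeHankelRecurrenceGaussElectrostaticBounds

/-!
# Venture HSemireg — **SECOND MOMENTS OF THE CLASSICAL ZEROS** (trace of `J²`, N298): for the zeros `x_0 < ⋯ < x_t` of the monic classical polynomials of degree `t + 1`:
# GEGENBAUER (`λ > 0`) **`Σ x_k² = t(t+1) ∕ (2(t+λ))`** (the couplings telescope: `b_n = ¼ − ¼ λ(λ−1)(1∕(n+λ−1) − 1∕(n+λ))`), LEGENDRE **`Σ x_k² = t(t+1)∕(2t+1)`**, CHEBYSHEV-`U` `Σ x_k² = t∕2`,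
# LAGUERRE **`Σ x_k² = (t+1)(t+1+α)(2t+1+α)`**; HERMITE `Σ x_k² = t(t+1)` is N359

HONEST FRAMING. Part of the Lean index of the computation cell `pub-hsemireg` (seat p10 gen 46, Sunday typer «UNIFORM-IN-n»).  Finite sums only; no variety, no cohomology theory, no sheaf, no Ext
group and no semiregularity map is constructed here; nothing here says that HC / HC_CM / HC_AV holds; no Literature fact (unproved `Prop`) is declared or used.  Custodian versions as in
`WedgeHankelSiegelIdeal` (1/3).
SOURCES (cited).  G. Szegő, *Orthogonal Polynomials*, §6.7 (power sums of the zeros from Stieltjes' relations), (4.7.17), (5.1.10); S. Ahmed, M. Bruschi, F. Calogero, M. A. Olshanetsky, A. M.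
Perelomov, *Properties of the zeros of the classical polynomials and of the Bessel functions*, Nuovo Cimento B 49 (1979) 173–199 (sum rules); F. Calogero, Lett. Nuovo Cimento 19 (1977) 505–508.
PROOF TYPED HERE.  N298 `sum_recurrence_zeros_sq` (`Σ x² = Σ a² + 2 Σ b`) and closed forms of the finite sums by induction (`field_simp; ring`).
DEDUP DISCLOSURE (`rg -n 'zeros_sq_sum|sum_recurrence_zeros_sq' Summits/Ventures/HSemireg`, 2026-09-03): N298 (general trace formula), N359 (Hermite `t(t+1)`); the Gegenbauer ∕ Legendre ∕
Laguerre closed forms are new.  The 5 names below: 0 hits tree-wide.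

WHAT IS IN THE TREE.  N298 `sum_recurrence_zeros_sq`; N390 ∕ N376 (the families' zeros).
THIS FILE (namespace `Summit.Ventures.HSemireg.Wedge.HankelOuter` continued; CHAINED on N393 (import only); 0 definitions):
* §1159 `gegenbauer_couplings_sum` (`Σ_{n=1}^{t} b_n = t(t+1)∕(4(t+λ))`), **`gegenbauer_zeros_sq_sum`**, **`legendre_zeros_sq_sum`**, `laguerre_trace_sq_sum` (the finite sum), **`laguerre_zeros_sq_sum`**.
CAVEATS.  Monic recurrences only.  Nothing Ext-side.  New names only.
-/

open Module Polynomial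
open scoped Matrix Polynomial

namespace Summit.Ventures.HSemireg.Wedge.HankelOuter

/-! ## §1159. Second moments of the classical zeros -/

/-- **`Σ_{i<t} b_{i+1} = t(t+1) ∕ (4(t+λ))`** for the ultraspherical couplings `b_{n+1} = (n+1)(n+2λ)∕(4(n+1+λ)(n+λ))` (`λ > 0`). [telescoping; this file, §1159] -/
theorem gegenbauer_couplings_sum {b : ℕ → ℝ} {lam : ℝ} (hb : ∀ n, b (n + 1) = ((n : ℝ) + 1) * ((n : ℝ) + 2 * lam) / (4 * ((n : ℝ) + 1 + lam) * ((n : ℝ) + lam))) (hlam : 0 < lam)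
    (t : ℕ) : ∑ i ∈ Finset.range t, b (i + 1) = (t : ℝ) * ((t : ℝ) + 1) / (4 * ((t : ℝ) + lam)) := by
  induction t with
  | zero => simp
  | succ t ih =>
    rw [Finset.sum_range_succ, ih, hb]
    have h0 : (0 : ℝ) ≤ t := Nat.cast_nonneg t
    push_cast
    field_simp
    ring

/-- **GEGENBAUER: `Σ_k x_k² = t(t+1) ∕ (2(t+λ))`** for the zeros of `C^{(λ)}_{t+1}` (monic recurrence, `λ > 0`). [Ahmed et al. 1979; this file, §1159] -/
theorem gegenbauer_zeros_sq_sum {q : ℕ → ℝ[X]} {a b : ℕ → ℝ} {lam : ℝ} (hq0 : q 0 = 1) (hq1 : q 1 = Polynomial.X - C (a 0))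
    (hrec : ∀ n, q (n + 2) = (Polynomial.X - C (a (n + 1))) * q (n + 1) - C (b (n + 1)) * q n) (ha : ∀ n, a n = 0)
    (hb : ∀ n, b (n + 1) = ((n : ℝ) + 1) * ((n : ℝ) + 2 * lam) / (4 * ((n : ℝ) + 1 + lam) * ((n : ℝ) + lam))) (hlam : 0 < lam)
    {t : ℕ} {x : Fin (t + 1) → ℝ} (hxq : q (t + 1) = ∏ k, (Polynomial.X - C (x k))) : ∑ k, x k ^ 2 = (t : ℝ) * ((t : ℝ) + 1) / (2 * ((t : ℝ) + lam)) := by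
  rcases t with _ | m
  · -- one zero, `x_0 = a_0 = 0`
    have h : (q 1).eval (x 0) = 0 := by rw [hxq, eval_prod]; exact Finset.prod_eq_zero (Finset.mem_univ 0) (by simp)
    rw [hq1, ha, C_0, sub_zero, eval_X] at h
    simp [h]
  · rw [sum_recurrence_zeros_sq hq0 hq1 hrec hxq, Finset.sum_eq_zero fun i _ => by rw [ha, zero_pow two_ne_zero], zero_add, gegenbauer_couplings_sum hb hlam (m + 1)]
    have h0 : (0 : ℝ) ≤ m := Nat.cast_nonneg m
    push_cast
    field_simp
    ring

/-- **LEGENDRE: `Σ_k x_k² = t(t+1) ∕ (2t+1)`** for the zeros of `P_{t+1}` (`b_n = n²∕(4n²−1)`). [Ahmed et al. 1979; this file, §1159] -/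
theorem legendre_zeros_sq_sum {q : ℕ → ℝ[X]} {a b : ℕ → ℝ} (hq0 : q 0 = 1) (hq1 : q 1 = Polynomial.X - C (a 0))
    (hrec : ∀ n, q (n + 2) = (Polynomial.X - C (a (n + 1))) * q (n + 1) - C (b (n + 1)) * q n) (ha : ∀ n, a n = 0)
    (hb : ∀ n, b (n + 1) = ((n : ℝ) + 1) ^ 2 / (4 * ((n : ℝ) + 1) ^ 2 - 1)) {t : ℕ} {x : Fin (t + 1) → ℝ} (hxq : q (t + 1) = ∏ k, (Polynomial.X - C (x k))) :
    ∑ k, x k ^ 2 = (t : ℝ) * ((t : ℝ) + 1) / (2 * (t : ℝ) + 1) := by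
  have hb' : ∀ n : ℕ, b (n + 1) = ((n : ℝ) + 1) * ((n : ℝ) + 2 * (1 / 2)) / (4 * ((n : ℝ) + 1 + 1 / 2) * ((n : ℝ) + 1 / 2)) := fun n => by
    rw [hb]
    have h0 : (0 : ℝ) ≤ n := Nat.cast_nonneg n
    have h1 : 4 * ((n : ℝ) + 1) ^ 2 - 1 ≠ 0 := by nlinarith
    have h2 : 4 * ((n : ℝ) + 1 + 1 / 2) * ((n : ℝ) + 1 / 2) ≠ 0 := by positivity
    rw [div_eq_div_iff h1 h2]; ring
  rw [gegenbauer_zeros_sq_sum hq0 hq1 hrec ha hb' (by norm_num) hxq]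
  have h0 : (0 : ℝ) ≤ t := Nat.cast_nonneg t
  rw [div_eq_div_iff (by positivity) (by positivity)]
  ring

/-- **`Σ_{i ≤ t} (2i+1+α)² + 2 Σ_{i<t} (i+1)(i+1+α) = (t+1)(t+1+α)(2t+1+α)`.** [bookkeeping; this file, §1159] -/
theorem laguerre_trace_sq_sum (α : ℝ) (t : ℕ) :
    ∑ i ∈ Finset.range (t + 1), (2 * (i : ℝ) + 1 + α) ^ 2 + 2 * ∑ i ∈ Finset.range t, ((i : ℝ) + 1) * ((i : ℝ) + 1 + α) = ((t : ℝ) + 1) * ((t : ℝ) + 1 + α) * (2 * (t : ℝ) + 1 + α) := by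
  induction t with
  | zero => simp; ring
  | succ t ih =>
    rw [Finset.sum_range_succ (fun i : ℕ => (2 * (i : ℝ) + 1 + α) ^ 2) (t + 1), Finset.sum_range_succ (fun i : ℕ => ((i : ℝ) + 1) * ((i : ℝ) + 1 + α)) t]
    push_cast
    linear_combination ih

/-- **LAGUERRE: `Σ_k x_k² = (t+1)(t+1+α)(2t+1+α)`** for the zeros of `L^{(α)}_{t+1}` (monic recurrence). [Ahmed et al. 1979; Szegő §6.7; this file, §1159] -/
theorem laguerre_zeros_sq_sum {L : ℕ → ℝ[X]} {a b : ℕ → ℝ} {α : ℝ} (hL0 : L 0 = 1) (hL1 : L 1 = Polynomial.X - C (a 0))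
    (hLrec : ∀ n, L (n + 2) = (Polynomial.X - C (a (n + 1))) * L (n + 1) - C (b (n + 1)) * L n) (ha : ∀ n, a n = 2 * n + 1 + α)
    (hb : ∀ n, b (n + 1) = ((n : ℝ) + 1) * ((n : ℝ) + 1 + α)) {t : ℕ} {x : Fin (t + 1) → ℝ} (hxq : L (t + 1) = ∏ k, (Polynomial.X - C (x k))) :
    ∑ k, x k ^ 2 = ((t : ℝ) + 1) * ((t : ℝ) + 1 + α) * (2 * (t : ℝ) + 1 + α) := by
  rcases t with _ | m
  · have h : (L 1).eval (x 0) = 0 := by rw [hxq, eval_prod]; exact Finset.prod_eq_zero (Finset.mem_univ 0) (by simp)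
    rw [hL1, ha, eval_sub, eval_X, eval_C] at h
    have hx : x 0 = 1 + α := by push_cast at h; linarith
    simp [hx]; ring
  · have e1 : ∑ i ∈ Finset.range (m + 2), a i ^ 2 = ∑ i ∈ Finset.range (m + 2), (2 * (i : ℝ) + 1 + α) ^ 2 := Finset.sum_congr rfl fun i _ => by rw [ha]
    have e2 : ∑ i ∈ Finset.range (m + 1), b (i + 1) = ∑ i ∈ Finset.range (m + 1), ((i : ℝ) + 1) * ((i : ℝ) + 1 + α) := Finset.sum_congr rfl fun i _ => by rw [hb]
    have h := laguerre_trace_sq_sum α (m + 1)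
    rw [show m + 1 + 1 = m + 2 from rfl] at h
    rw [sum_recurrence_zeros_sq hL0 hL1 hLrec hxq, e1, e2]
    exact h

end Summit.Ventures.HSemireg.Wedge.HankelOuter
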